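import Summits.QuantumFields.YangMills.Theorems.BalabanUVNodesK0Stub3V20Sockets

/-!
# K0⁷ — STUB 3 UNDER THE V20 TEXTS, COMPANION: the RUN-WISE face 3ᴿ ([I] Thm 3 p.264 «uniformly bounded» ALONG THE RUNS, DEF-1's letter `RunConstRemainder β (fun _ => 0) β′ γ₀`) with
# the V20 antecedents (R ∕ G♭), its uniform ∕ token-free cores, box ⟹ runs, the chain G♭ ⟹ R ⟹ V19 for runs, the A1-witness road schema, and K0⁷ BY NAME under the V20-R stub-1 text from a
# RUN letter (k0-s1-w3 g7's hcomp-closer p630016 + print-cube supplier p630277 + stub 2′ p595104)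

Cell `pub-ymgap`, width seat `pub-ymgap-k0-s3-w2` (g3; director-ym R399 (3a) ∕ №207; bus CLAIM-1 I.37129, CLAIM-2 = this file).  `--kind proof --supports stmt-QuantumFields-20541 --as helper`
(count-neutral).  NEW leaf; theorems only; 0 `def`; nothing modified; no registry write.  Companion of `…K0Stub3V20Sockets` (the box sockets), imported.
[15] = [Balaban1985Variational]; [6] = [Balaban1985RegularSpaces]; [I] = [Balaban1987RG1]; [II] = [Balaban1989LargeFieldII]; [III] = [Balaban1988Convergent].

WHY.  Plan g86's WORD V20 = G (bus I.37134) re-letters the antecedents of K0⁷'s stub 3; the stub-3 lane's PRINT-FAITHFUL sub-face is the run-wise one (3ᴿ, `…K0Stub3RunwiseFace` p607023: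
[I]'s Thm 3 bounds β only along solutions of (0.20) staying in `]0, γ₀]`; plan g83 «3ᴿ BOOKED for the next K0 edition», bus I.29305).  THIS FILE re-keys 3ᴿ to the V20 antecedents exactly as
`…K0Stub3V20Sockets` does for the box: (§1) 3ᴿ-R (floor-carrying antecedents) ⟺ its uniform run core ((j,c)-genericity free by `…CubeLetterBlind` §1); the token-free RUN core and the
token-free BOX core (box ⟹ runs about zero, `runConstRemainder_zero_of_absBox`) pay it; 3ᴬ′-R ⟹ 3ᴿ-R; 3ᴿ-G♭ ⟹ 3ᴿ-R ⟹ V19's 3ᴿ (weaker tokens = stronger socket, `c₀ := 0`); (§2) the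
A1-witness road schema for boxes (twin of `…V20Sockets` §5 at `θ₁₅ᶜᶜᴹ(j)` with any sub-window — the (5.10) window-uniform road p608074, the C¹-witness ∕ jets-free-pair roads); (§3) K0⁷'s
body under the V20-R stub-1 TEXT from a floor-carrying (9)-supplier and 3ᴿ-R (p607023 §3 `clausesH_of_runAbsBox` + k0-s1-w3 g7's all-torus hcomp-closer at `h15R`, p630016), and K0⁷ BY NAME
from {V20-R stub-1 text, stub 2′ BY NAME (p595104 through p630277's `gauge9SupplierR_of_prop6MemberP`), ONE of: 3ᴿ-R ∕ 3ᴿ-G♭ ∕ the token-free run core ∕ a §2 road}.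

HONEST FRAMING.  By-name plumbing between typed socket SHAPES over landed letters; NO β estimate; nothing of Bałaban asserted; every [15] ∕ [6] ∕ [I] sentence is a HYPOTHESIS inhabited
nowhere; 3ᴿ (any text) remains NODE O's wall ([I] §1 p.264 ∕ Thm 3 «uniformly bounded» STATED, proof unpublished [II] p.355); no stub proved; K0⁷ stmt-QuantumFields-20541 OPEN (V19 STANDS;
the V20-G registration is the plan's act; this file registers nothing); counts unmoved (typed 28∕28 · discharged 5∕27, A 5∕28 — the chair's words).  One finite 𝕋⁴ programme at fixed
`ε = L^{−K}`, Bałaban AS PRINTED — NOT continuum ∕ ℝ⁴ ∕ OS ∕ mass gap ∕ Clay (the Yang–Mills mass gap is NOT proved by any of this; route R4 closes the CONDITIONAL finite-𝕋⁴ rung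
`BalabanLadder.UV` only).  No `sorry`, `def`, `instance`, `notation`, `axiom`.
-/

noncomputable section

open scoped Matrix.Norms.L2Operator

namespace Summit.QuantumFields.YangMills.Theorems.K0Stub3V20RunSockets

open Literature.MathematicalPhysics.QuantumFieldTheory.Balaban1983to89
open Literature.MathematicalPhysics.QuantumFieldTheory.Balaban1983to89.Node00
open Literature.MathematicalPhysics.QuantumFieldTheory.Balaban1983to89.T4Continuum
open Literature.MathematicalPhysics.QuantumFieldTheory.Balaban1983to89.FlowStep
open Summit.QuantumFields.YangMills.Theorems.BalabanUVNodesK2NamedJetsRunRemAt (RunConstRemainder)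
open Summit.QuantumFields.YangMills.Theorems.K0V19Defs (Prop8StepCoPAt)
open Summit.QuantumFields.YangMills.Theorems.K0V19Stub2Prime (stub_prop6MemberB8AtP13)
open Summit.QuantumFields.YangMills.Theorems.K0Stub3RunwiseFace (runConstRemainder_zero_of_absBox clausesH_of_runAbsBox record13SepCoPHInhabited_of_stub1_run3R_byName)
open Summit.QuantumFields.YangMills.Theorems.K0Stub3CubeLetterBlind (betaOfRecord₁₃_theta13OfThm1CCM_letterBlind)
open Summit.QuantumFields.YangMills.BalabanUVNodes.N07Thm1Top7FromProp8 (variationalThm1RegSepCoP7MR_of_prop8TopStepR)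
open Summit.QuantumFields.YangMills.Theorems.K0AllTorusOfStepTokensRFloor (exists_k0SepCoPH_thm1CCMW_of_thm1RegSepCoP7MR_of_gauge9TopStepR_of_hcomp_allTorus)
open Summit.QuantumFields.YangMills.Theorems.K0PrintCubeOfStepTokensRFloor (gauge9SupplierR_of_prop6MemberP)
open Summit.QuantumFields.YangMills.Theorems.K0Stub3V20Sockets (tokensG_of_tokensR tokensR_of_tokensV19)

variable (F : T4Family)

/-! ## §1  The run-wise face under the V20 antecedents: uniform ∕ token-free cores, box ⟹ runs, G♭ ⟹ R ⟹ V19 -/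

section RunFace

/-- **★ 3ᴿ-R ⟺ ITS UNIFORM CORE** (p608905 §3's `run3R_iff_uniform` with the floor-carrying first antecedent `VariationalThm1RegSepCoP7MR F 2 c B₃ a₀ a₁`, same `c` as the (9)-antecedent):
for every threshold `a₀ > 0` at which the R-tokens are inhabited, SOME `γ₀, ε₂₉ > 0`, `β′` give DEF-1's run letter for ALL `j, ε₀, B₃, B₃′, a₁` at once.  A repackaging; nothing asserted.
[cite: Balaban1987RG1, Thm 1 p.259, Thm 3 p.264, (1.20)–(1.22) p.264, (2.9) p.266; Balaban1985Variational, Thm 1 (8)–(9) p.279, p.304 lines 1–2] -/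
theorem run3RR_iff_uniformRunR :
    (∀ (j c : ℕ) (B₃ B₃' a₀ a₁ : ℝ), c ≤ F.L ^ j → 2 * (F.L : ℝ) ^ 2 ≤ B₃ → 0 < B₃' → 0 < a₀ → 0 < a₁ →
      VariationalThm1RegSepCoP7MR F 2 c B₃ a₀ a₁ →
      Gauge9RegSepTopStepR F 2 (fun ν K Ω => suppDomOfRecord F ν K Ω) (F.L ^ j) c B₃ B₃' a₀ a₁ →
      ∃ γ₀ ε₀ ε₂₉ β' : ℝ, 0 < γ₀ ∧ 0 < ε₀ ∧ 0 < ε₂₉ ∧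
        RunConstRemainder (betaOfRecord₁₃ F 2 (theta13OfThm1CCM F 2 j ε₀ ε₂₉ B₃ B₃' a₀ a₁)) (fun _ => 0) β' γ₀) ↔
      ∀ a₀ : ℝ, 0 < a₀ →
        (∃ (j c : ℕ) (B₃ B₃' a₁ : ℝ), c ≤ F.L ^ j ∧ 2 * (F.L : ℝ) ^ 2 ≤ B₃ ∧ 0 < B₃' ∧ 0 < a₁ ∧
          VariationalThm1RegSepCoP7MR F 2 c B₃ a₀ a₁ ∧
          Gauge9RegSepTopStepR F 2 (fun ν K Ω => suppDomOfRecord F ν K Ω) (F.L ^ j) c B₃ B₃' a₀ a₁) →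
        ∃ γ₀ ε₂₉ β' : ℝ, 0 < γ₀ ∧ 0 < ε₂₉ ∧ ∀ (j : ℕ) (ε₀ B₃ B₃' a₁ : ℝ),
          RunConstRemainder (betaOfRecord₁₃ F 2 (theta13OfThm1CCM F 2 j ε₀ ε₂₉ B₃ B₃' a₀ a₁)) (fun _ => 0) β' γ₀ := by
  constructor
  · rintro h a₀ ha₀ ⟨j, c, B₃, B₃', a₁, hc, hB₃, hB₃', ha₁, h15, h9⟩
    obtain ⟨γ₀, ε₀, ε₂₉, β', hγ₀, -, hε', hR⟩ := h j c B₃ B₃' a₀ a₁ hc hB₃ hB₃' ha₀ ha₁ h15 h9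
    refine ⟨γ₀, ε₂₉, β', hγ₀, hε', fun j' ε₀' C₃ C₃' c₁ => ?_⟩
    rw [betaOfRecord₁₃_theta13OfThm1CCM_letterBlind F 2 j' j ε₀' ε₀ ε₂₉ C₃ B₃ C₃' B₃' a₀ c₁ a₁]
    exact hR
  · intro h j c B₃ B₃' a₀ a₁ hc hB₃ hB₃' ha₀ ha₁ h15 h9
    obtain ⟨γ₀, ε₂₉, β', hγ₀, hε', hall⟩ := h a₀ ha₀ ⟨j, c, B₃, B₃', a₁, hc, hB₃, hB₃', ha₁, h15, h9⟩
    exact ⟨γ₀, 1, ε₂₉, β', hγ₀, one_pos, hε', hall j 1 B₃ B₃' a₁⟩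

/-- **THE TOKEN-FREE RUN CORE PAYS 3ᴿ-R** (p608905's `run3R_of_tokenFree` hypothesis VERBATIM: ONE run letter of `β₁₃(F; a₀, ε₂₉)` per threshold).  CONDITIONAL; nothing asserted.
[cite: Balaban1987RG1, Thm 1 p.259, Thm 3 p.264; Balaban1985Variational, Thm 1 (8)–(9) p.279, p.304 lines 1–2; Balaban1989LargeFieldII, p.355] -/
theorem run3RR_of_tokenFreeRun
    (h : ∀ a₀ : ℝ, 0 < a₀ → ∃ γ₀ ε₂₉ β' : ℝ, 0 < γ₀ ∧ 0 < ε₂₉ ∧ ∀ (j : ℕ) (ε₀ B₃ B₃' a₁ : ℝ),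
      RunConstRemainder (betaOfRecord₁₃ F 2 (theta13OfThm1CCM F 2 j ε₀ ε₂₉ B₃ B₃' a₀ a₁)) (fun _ => 0) β' γ₀) :
    ∀ (j c : ℕ) (B₃ B₃' a₀ a₁ : ℝ), c ≤ F.L ^ j → 2 * (F.L : ℝ) ^ 2 ≤ B₃ → 0 < B₃' → 0 < a₀ → 0 < a₁ →
      VariationalThm1RegSepCoP7MR F 2 c B₃ a₀ a₁ →
      Gauge9RegSepTopStepR F 2 (fun ν K Ω => suppDomOfRecord F ν K Ω) (F.L ^ j) c B₃ B₃' a₀ a₁ →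
      ∃ γ₀ ε₀ ε₂₉ β' : ℝ, 0 < γ₀ ∧ 0 < ε₀ ∧ 0 < ε₂₉ ∧
        RunConstRemainder (betaOfRecord₁₃ F 2 (theta13OfThm1CCM F 2 j ε₀ ε₂₉ B₃ B₃' a₀ a₁)) (fun _ => 0) β' γ₀ :=
  (run3RR_iff_uniformRunR F).mpr fun a₀ ha₀ _ => h a₀ ha₀

/-- **THE TOKEN-FREE BOX CORE PAYS 3ᴿ-R** (box ⟹ runs about zero, p607023 `runConstRemainder_zero_of_absBox`; the converse is NOT claimed — p609916's separation).  CONDITIONAL.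
[cite: Balaban1987RG1, §1 (1.22) p.264, Thm 3 p.264 (bookkeeping); Balaban1985Variational, Thm 1 (8)–(9) p.279] -/
theorem run3RR_of_tokenFree
    (h : ∀ a₀ : ℝ, 0 < a₀ → ∃ γ₀ ε₂₉ β' : ℝ, 0 < γ₀ ∧ 0 < ε₂₉ ∧ ∀ (j : ℕ) (ε₀ B₃ B₃' a₁ : ℝ),
      BetaLowerH (-β') γ₀ (betaOfRecord₁₃ F 2 (theta13OfThm1CCM F 2 j ε₀ ε₂₉ B₃ B₃' a₀ a₁)) ∧
      BetaUpperH β' γ₀ (betaOfRecord₁₃ F 2 (theta13OfThm1CCM F 2 j ε₀ ε₂₉ B₃ B₃' a₀ a₁))) :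
    ∀ (j c : ℕ) (B₃ B₃' a₀ a₁ : ℝ), c ≤ F.L ^ j → 2 * (F.L : ℝ) ^ 2 ≤ B₃ → 0 < B₃' → 0 < a₀ → 0 < a₁ →
      VariationalThm1RegSepCoP7MR F 2 c B₃ a₀ a₁ →
      Gauge9RegSepTopStepR F 2 (fun ν K Ω => suppDomOfRecord F ν K Ω) (F.L ^ j) c B₃ B₃' a₀ a₁ →
      ∃ γ₀ ε₀ ε₂₉ β' : ℝ, 0 < γ₀ ∧ 0 < ε₀ ∧ 0 < ε₂₉ ∧
        RunConstRemainder (betaOfRecord₁₃ F 2 (theta13OfThm1CCM F 2 j ε₀ ε₂₉ B₃ B₃' a₀ a₁)) (fun _ => 0) β' γ₀ := by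
  refine run3RR_of_tokenFreeRun F fun a₀ ha₀ => ?_
  obtain ⟨γ₀, ε₂₉, β', hγ₀, hε', hall⟩ := h a₀ ha₀
  exact ⟨γ₀, ε₂₉, β', hγ₀, hε', fun j ε₀ B₃ B₃' a₁ => runConstRemainder_zero_of_absBox (hall j ε₀ B₃ B₃' a₁).1 (hall j ε₀ B₃ B₃' a₁).2⟩

/-- **3ᴬ′-R ⟹ 3ᴿ-R** (same tuple; the box's in-window run prefixes lie in the box).  CONDITIONAL. [cite: Balaban1987RG1, §1 (1.22) p.264, Thm 3 p.264 (bookkeeping); Balaban1985Variational, Thm 1 (8)–(9) p.279] -/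
theorem run3RR_of_abs3A'R
    (h : ∀ (j c : ℕ) (B₃ B₃' a₀ a₁ : ℝ), c ≤ F.L ^ j → 2 * (F.L : ℝ) ^ 2 ≤ B₃ → 0 < B₃' → 0 < a₀ → 0 < a₁ →
      VariationalThm1RegSepCoP7MR F 2 c B₃ a₀ a₁ →
      Gauge9RegSepTopStepR F 2 (fun ν K Ω => suppDomOfRecord F ν K Ω) (F.L ^ j) c B₃ B₃' a₀ a₁ →
      ∃ γ₀ ε₀ ε₂₉ β' : ℝ, 0 < γ₀ ∧ 0 < ε₀ ∧ 0 < ε₂₉ ∧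
        BetaLowerH (-β') γ₀ (betaOfRecord₁₃ F 2 (theta13OfThm1CCM F 2 j ε₀ ε₂₉ B₃ B₃' a₀ a₁)) ∧
        BetaUpperH β' γ₀ (betaOfRecord₁₃ F 2 (theta13OfThm1CCM F 2 j ε₀ ε₂₉ B₃ B₃' a₀ a₁))) :
    ∀ (j c : ℕ) (B₃ B₃' a₀ a₁ : ℝ), c ≤ F.L ^ j → 2 * (F.L : ℝ) ^ 2 ≤ B₃ → 0 < B₃' → 0 < a₀ → 0 < a₁ →
      VariationalThm1RegSepCoP7MR F 2 c B₃ a₀ a₁ →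
      Gauge9RegSepTopStepR F 2 (fun ν K Ω => suppDomOfRecord F ν K Ω) (F.L ^ j) c B₃ B₃' a₀ a₁ →
      ∃ γ₀ ε₀ ε₂₉ β' : ℝ, 0 < γ₀ ∧ 0 < ε₀ ∧ 0 < ε₂₉ ∧
        RunConstRemainder (betaOfRecord₁₃ F 2 (theta13OfThm1CCM F 2 j ε₀ ε₂₉ B₃ B₃' a₀ a₁)) (fun _ => 0) β' γ₀ := by
  intro j c B₃ B₃' a₀ a₁ hc hB hB' ha₀ ha₁ h15 h9
  obtain ⟨γ₀, ε₀, ε₂₉, β', hγ₀, hε, hε', hlow, hup⟩ := h j c B₃ B₃' a₀ a₁ hc hB hB' ha₀ ha₁ h15 h9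
  exact ⟨γ₀, ε₀, ε₂₉, β', hγ₀, hε, hε', runConstRemainder_zero_of_absBox hlow hup⟩

/-- **3ᴿ-G♭ ⟹ 3ᴿ-R** (the run letter under the GUARDED antecedents at `fun ν _M _g K k _s => c ≤ ν.M₁ ∧ k + c₀ ≤ F.m + K` with the level binder `c₀ ≤ j + 1` is the STRONGER socket:
R-tokens are G-tokens at `c₀ := 0`, `…V20Sockets.tokensG_of_tokensR`; the binder-free G variant follows by ignoring the binder).  CONDITIONAL.
[cite: Balaban1987RG1, Thm 3 p.264, §1 p.264, (0.1) p.251; Balaban1985Variational, Thm 1 (8)–(9) p.279, p.304 lines 1–2 (bookkeeping)] -/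
theorem run3RR_of_run3RGb
    (h : ∀ (j c c₀ : ℕ) (B₃ B₃' a₀ a₁ : ℝ), c ≤ F.L ^ j → c₀ ≤ j + 1 → 2 * (F.L : ℝ) ^ 2 ≤ B₃ → 0 < B₃' → 0 < a₀ → 0 < a₁ →
      VariationalThm1RegSepCoP7MG F 2 (fun ν _M _g K k _s => c ≤ ν.M₁ ∧ k + c₀ ≤ F.m + K) B₃ a₀ a₁ →
      Gauge9RegSepTopStepG F 2 (fun ν K Ω => suppDomOfRecord F ν K Ω) (F.L ^ j) (fun ν _M _g K k _s => c ≤ ν.M₁ ∧ k + c₀ ≤ F.m + K) B₃ B₃' a₀ a₁ →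
      ∃ γ₀ ε₀ ε₂₉ β' : ℝ, 0 < γ₀ ∧ 0 < ε₀ ∧ 0 < ε₂₉ ∧
        RunConstRemainder (betaOfRecord₁₃ F 2 (theta13OfThm1CCM F 2 j ε₀ ε₂₉ B₃ B₃' a₀ a₁)) (fun _ => 0) β' γ₀) :
    ∀ (j c : ℕ) (B₃ B₃' a₀ a₁ : ℝ), c ≤ F.L ^ j → 2 * (F.L : ℝ) ^ 2 ≤ B₃ → 0 < B₃' → 0 < a₀ → 0 < a₁ →
      VariationalThm1RegSepCoP7MR F 2 c B₃ a₀ a₁ →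
      Gauge9RegSepTopStepR F 2 (fun ν K Ω => suppDomOfRecord F ν K Ω) (F.L ^ j) c B₃ B₃' a₀ a₁ →
      ∃ γ₀ ε₀ ε₂₉ β' : ℝ, 0 < γ₀ ∧ 0 < ε₀ ∧ 0 < ε₂₉ ∧
        RunConstRemainder (betaOfRecord₁₃ F 2 (theta13OfThm1CCM F 2 j ε₀ ε₂₉ B₃ B₃' a₀ a₁)) (fun _ => 0) β' γ₀ := by
  intro j c B₃ B₃' a₀ a₁ hc hB hB' ha₀ ha₁ h15 h9
  obtain ⟨h15G, h9G⟩ := tokensG_of_tokensR F 0 h15 h9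
  exact h j c 0 B₃ B₃' a₀ a₁ hc (Nat.zero_le _) hB hB' ha₀ ha₁ h15G h9G

/-- **3ᴿ-R ⟹ V19's 3ᴿ** (`…K0Stub3RunwiseFace`'s text with V19's floor-free first antecedent): V19-tokens are R-tokens at the same `c` (`…V20Sockets.tokensR_of_tokensV19`).  So every by-name
road from V19's 3ᴿ (p607023 `record13SepCoPHInhabited_of_stub1_run3R_byName`, p608905 §4) stays available to an R-run supplier.  CONDITIONAL. [cite: Balaban1987RG1, Thm 3 p.264 (bookkeeping); Balaban1985Variational, Thm 1 (8)–(9) p.279] -/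
theorem run3RV19_of_run3RR
    (h : ∀ (j c : ℕ) (B₃ B₃' a₀ a₁ : ℝ), c ≤ F.L ^ j → 2 * (F.L : ℝ) ^ 2 ≤ B₃ → 0 < B₃' → 0 < a₀ → 0 < a₁ →
      VariationalThm1RegSepCoP7MR F 2 c B₃ a₀ a₁ →
      Gauge9RegSepTopStepR F 2 (fun ν K Ω => suppDomOfRecord F ν K Ω) (F.L ^ j) c B₃ B₃' a₀ a₁ →
      ∃ γ₀ ε₀ ε₂₉ β' : ℝ, 0 < γ₀ ∧ 0 < ε₀ ∧ 0 < ε₂₉ ∧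
        RunConstRemainder (betaOfRecord₁₃ F 2 (theta13OfThm1CCM F 2 j ε₀ ε₂₉ B₃ B₃' a₀ a₁)) (fun _ => 0) β' γ₀) :
    ∀ (j c : ℕ) (B₃ B₃' a₀ a₁ : ℝ), c ≤ F.L ^ j → 2 * (F.L : ℝ) ^ 2 ≤ B₃ → 0 < B₃' → 0 < a₀ → 0 < a₁ →
      VariationalThm1RegSepCoP7M F 2 B₃ a₀ a₁ →
      Gauge9RegSepTopStepR F 2 (fun ν K Ω => suppDomOfRecord F ν K Ω) (F.L ^ j) c B₃ B₃' a₀ a₁ →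
      ∃ γ₀ ε₀ ε₂₉ β' : ℝ, 0 < γ₀ ∧ 0 < ε₀ ∧ 0 < ε₂₉ ∧
        RunConstRemainder (betaOfRecord₁₃ F 2 (theta13OfThm1CCM F 2 j ε₀ ε₂₉ B₃ B₃' a₀ a₁)) (fun _ => 0) β' γ₀ :=
  fun j c B₃ B₃' a₀ a₁ hc hB hB' ha₀ ha₁ h15 h9 => h j c B₃ B₃' a₀ a₁ hc hB hB' ha₀ ha₁ (tokensR_of_tokensV19 F h15 h9).1 h9

end RunFace

/-! ## §2  The A1-witness road schema (boxes on any sub-window at `θ₁₅ᶜᶜᴹ(j)` — the twin of `…V20Sockets` §5) -/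

section Schema

/-- **★★ A1's WITNESSES, ANY SUB-WINDOW.**  Let `P θ` be any package of letters for which the lane holds a θ-generic box road returning a box on SOME window `γ₀ > 0`
(`P θ → ∃ γ₀ β′, 0 < γ₀ ∧ BetaLowerH (−β′) γ₀ β₁₃(θ) ∧ BetaUpperH β′ γ₀ β₁₃(θ)` — the (5.10) window-uniform road p608074, the C¹-witness ∕ jets-free-pair roads of dag-n26-c ∕ an4 ∕ N26 read
through `…CubeLetterBlind.…_eq_CC1`).  If for every threshold `a₀ > 0` the package is inhabited at ONE of A1's collared witnesses `θ₁₅ᶜᶜᴹ(j; ε₀, ε₂₉; B₃, B₃′, a₀, a₁)` with `0 < ε₂₉`, then the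
TOKEN-FREE box core holds at `F` (letter-blindness spreads the one box over all `(j, ε₀, B₃, B₃′, a₁)`), hence every V20 text (`…V20Sockets` §3) and §1's run texts.  CONDITIONAL on the road and on `P`.
[cite: Balaban1987RG1, Thm 1 p.255, §1 (1.20)–(1.22) p.264, (5.10) p.293; Balaban1988RG2Cluster, Lemma 3 (2.38) p.20; Balaban1989LargeFieldII, p.355] -/
theorem tokenFree_of_genericRoadAtWitness (P : Stage13Params F 2 → Prop)
    (hroad : ∀ θ : Stage13Params F 2, P θ → ∃ γ₀ β' : ℝ, 0 < γ₀ ∧ BetaLowerH (-β') γ₀ (betaOfRecord₁₃ F 2 θ) ∧ BetaUpperH β' γ₀ (betaOfRecord₁₃ F 2 θ))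
    (hAt : ∀ a₀ : ℝ, 0 < a₀ → ∃ (j : ℕ) (ε₀ ε₂₉ B₃ B₃' a₁ : ℝ), 0 < ε₂₉ ∧ P (theta13OfThm1CCM F 2 j ε₀ ε₂₉ B₃ B₃' a₀ a₁)) :
    ∀ a₀ : ℝ, 0 < a₀ → ∃ γ₀ ε₂₉ β' : ℝ, 0 < γ₀ ∧ 0 < ε₂₉ ∧ ∀ (j : ℕ) (ε₀ B₃ B₃' a₁ : ℝ),
      BetaLowerH (-β') γ₀ (betaOfRecord₁₃ F 2 (theta13OfThm1CCM F 2 j ε₀ ε₂₉ B₃ B₃' a₀ a₁)) ∧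
      BetaUpperH β' γ₀ (betaOfRecord₁₃ F 2 (theta13OfThm1CCM F 2 j ε₀ ε₂₉ B₃ B₃' a₀ a₁)) := by
  intro a₀ ha₀
  obtain ⟨j, ε₀, ε₂₉, B₃, B₃', a₁, hε', hP⟩ := hAt a₀ ha₀
  obtain ⟨γ₀, β', hγ₀, hlow, hup⟩ := hroad _ hP
  refine ⟨γ₀, ε₂₉, β', hγ₀, hε', fun j' ε₀' C₃ C₃' c₁ => ?_⟩
  rw [betaOfRecord₁₃_theta13OfThm1CCM_letterBlind F 2 j' j ε₀' ε₀ ε₂₉ C₃ B₃ C₃' B₃' a₀ c₁ a₁]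
  exact ⟨hlow, hup⟩

end Schema

/-! ## §3  K0⁷ under the V20-R stub-1 TEXT from a RUN letter: the body at `(L^j, c)`, the generic-supplier composition, and K0⁷ BY NAME (stub 2′ by name, p595104) -/

section ByName

variable {F}

/-- **★ THE ⁷ K0 BODY FOR `F` AT AN ARBITRARY CUBE LETTER `(L^j, c)`, `c ≤ L^j`, FROM THE FLOOR-CARRYING (8) AT FLOOR `c`, THE (9)-TOKEN AT `(L^j, c)` AND ONE RUN-WISE LETTER OF
`θ₁₅ᶜᶜᴹ(j)`** — p607023 §3's `exists_k0H_of_thm1CoP7M_of_gauge9R_of_runAbsBox` at `h15R`: `clausesH_of_runAbsBox` (token-free) gives (hcomp) ∧ (hcompRev) at `θ₁₅ᶜᶜᴹᵂ(j; γ)`, then k0-s1-w3 g7's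
all-torus closer `exists_k0SepCoPH_thm1CCMW_of_thm1RegSepCoP7MR_of_gauge9TopStepR_of_hcomp_allTorus` (p630016).  CONDITIONAL.
[cite: Balaban1985Variational, Thm 1 (8)–(9) p.279, (144)–(152) pp.300–301, Prop. 8 p.304, p.304 lines 1–2; Balaban1988Convergent, Thm 1 p.262, (2.6)–(2.8) pp.255–256, p.257, (2.21) p.258; Balaban1987RG1, Thm 1 p.259, (1.12) p.262, Thm 3 p.264] -/
theorem exists_k0H_of_thm1CoP7MR_of_gauge9R_of_runAbsBox (F : T4Family) {j c : ℕ} (hc : c ≤ F.L ^ j) {B₃ B₉ a₀ a₁ : ℝ} (hB₃ : 0 ≤ B₃) (hB₉ : 0 ≤ B₉)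
    (ha₀ : 0 < a₀) (ha₁ : 0 < a₁) (h15 : VariationalThm1RegSepCoP7MR F 2 c B₃ a₀ a₁)
    (h9 : Gauge9RegSepTopStepR F 2 (fun ν K Ω => suppDomOfRecord F ν K Ω) (F.L ^ j) c B₃ B₉ a₀ a₁)
    (h3R : ∃ γ₀ ε₀ ε₂₉ β' : ℝ, 0 < γ₀ ∧ 0 < ε₀ ∧ 0 < ε₂₉ ∧
        RunConstRemainder (betaOfRecord₁₃ F 2 (theta13OfThm1CCM F 2 j ε₀ ε₂₉ B₃ B₉ a₀ a₁)) (fun _ => 0) β' γ₀) :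
    ∃ θ : Stage13HParams F 2, θ.Provisos₁₃SepCoPH F 2 ∧ (θ.ZhUnity F 2 ∧ θ.SlotsNondegenerate₁₃ F 2) ∧ θ.Admissible F 2 := by
  obtain ⟨γ, ε₀, ε₂₉, hγ0, hγ, hε, hε', hcomp, hcompRev⟩ := clausesH_of_runAbsBox F j hB₃ hB₉ ha₀.le ha₁.le h3R
  exact exists_k0SepCoPH_thm1CCMW_of_thm1RegSepCoP7MR_of_gauge9TopStepR_of_hcomp_allTorus F hγ0 hγ hε hε' hB₃ hB₉ ha₀ ha₁ h15 hc h9 hcomp hcompRev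

/-- **★★ K0⁷'s BODY AT EVERY FAMILY FROM V20-R's STUB 1, A GENERIC FLOOR-CARRYING (9)-SUPPLIER, AND 3ᴿ-R** — k0-s1-w3 g7's `record13SepCoPHBody_of_stub1R_of_gauge9SupplierR_of_absBetaBoxAtR`
(p630016 §4) with the box replaced by the RUNS (p607023 §4's pattern): stub 1-R ⇒ the floor-carrying (8) at floor `c′ ≥ c` (module 50's `variationalThm1RegSepCoP7MR_of_prop8TopStepR`, ceiling shrunk
by `.of_le`, floor raised by `.mono_floor`), `hSR` ⇒ (9) at `(L^j, c′)`, `h3RR` there ⇒ the run letter ⇒ the previous theorem.  CONDITIONAL; K0⁷ NOT closed here; nothing of Bałaban asserted.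
[cite: Balaban1985Variational, Thm 1 (8)–(9) p.279, (144)–(152) pp.300–301, Prop. 8 p.304, p.304 lines 1–2; Balaban1985RegularSpaces, (1.3)–(1.6) p.77, Prop. 6 p.99, p.98; Balaban1988Convergent, Thm 1 p.262, (2.6)–(2.8) pp.255–256; Balaban1987RG1, Thm 1 p.259, Thm 3 p.264] -/
theorem record13SepCoPHBody_of_stub1R_of_gauge9SupplierR_of_run3RR
    (h1R : ∀ F : T4Family, ∃ (c : ℕ) (B₃ a₀ a₁ : ℝ), 2 * (F.L : ℝ) ^ 2 ≤ B₃ ∧ 0 < a₀ ∧ 0 < a₁ ∧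
      Prop8RegSepTopStepR F 2 (fun ν K Ω => suppDomOfRecord F ν K Ω) c B₃ a₀ a₁)
    (hSR : ∀ (F : T4Family) (c : ℕ) (B₃ a₀ a₁ : ℝ), 2 * (F.L : ℝ) ^ 2 ≤ B₃ → 0 < a₀ → 0 < a₁ →
      Prop8RegSepTopStepR F 2 (fun ν K Ω => suppDomOfRecord F ν K Ω) c B₃ a₀ a₁ →
      ∃ (j c' : ℕ) (B₉ a₁' : ℝ), c ≤ c' ∧ c' ≤ F.L ^ j ∧ 0 < B₉ ∧ 0 < a₁' ∧ a₁' ≤ a₁ ∧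
        Gauge9RegSepTopStepR F 2 (fun ν K Ω => suppDomOfRecord F ν K Ω) (F.L ^ j) c' B₃ B₉ a₀ a₁')
    (h3RR : ∀ (F : T4Family) (j c : ℕ) (B₃ B₃' a₀ a₁ : ℝ), c ≤ F.L ^ j → 2 * (F.L : ℝ) ^ 2 ≤ B₃ → 0 < B₃' → 0 < a₀ → 0 < a₁ →
      VariationalThm1RegSepCoP7MR F 2 c B₃ a₀ a₁ →
      Gauge9RegSepTopStepR F 2 (fun ν K Ω => suppDomOfRecord F ν K Ω) (F.L ^ j) c B₃ B₃' a₀ a₁ →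
      ∃ γ₀ ε₀ ε₂₉ β' : ℝ, 0 < γ₀ ∧ 0 < ε₀ ∧ 0 < ε₂₉ ∧
        RunConstRemainder (betaOfRecord₁₃ F 2 (theta13OfThm1CCM F 2 j ε₀ ε₂₉ B₃ B₃' a₀ a₁)) (fun _ => 0) β' γ₀) :
    ∀ F : T4Family, ∃ θ : Stage13HParams F 2, θ.Provisos₁₃SepCoPH F 2 ∧ (θ.ZhUnity F 2 ∧ θ.SlotsNondegenerate₁₃ F 2) ∧ θ.Admissible F 2 := by
  intro F
  obtain ⟨c, B₃, a₀, a₁, hB₃, ha₀, ha₁, h8⟩ := h1R F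
  have hL : (0 : ℝ) < (F.L : ℝ) := by exact_mod_cast lt_trans Nat.zero_lt_one F.hL.2
  have hBpos : (0 : ℝ) < B₃ := lt_of_lt_of_le (mul_pos two_pos (pow_pos hL 2)) hB₃
  obtain ⟨j, c', B₉, a₁', hcc', hc', hB₉, ha₁', ha₁'le, h9⟩ := hSR F c B₃ a₀ a₁ hB₃ ha₀ ha₁ h8
  have h15 : VariationalThm1RegSepCoP7MR F 2 c' B₃ a₀ a₁' :=
    variationalThm1RegSepCoP7MR_of_prop8TopStepR hBpos ((h8.of_le le_rfl ha₁'le).mono_floor hcc')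
  exact exists_k0H_of_thm1CoP7MR_of_gauge9R_of_runAbsBox F hc' hBpos.le hB₉.le ha₀ ha₁' h15 h9 (h3RR F j c' B₃ B₉ a₀ a₁' hc' hB₃ hB₉ ha₀ ha₁' h15 h9)

/-- **★★★ K0⁷ BY NAME FROM THE V20-R STUB-1 TEXT AND 3ᴿ-R** — stub 2′ DISCHARGED BY NAME (`K0V19Stub2Prime.stub_prop6MemberB8AtP13`, p595104) through k0-s1-w3 g7's print-cube R-supplier
`gauge9SupplierR_of_prop6MemberP` (p630277).  On this road the open K0⁷ bill reads {V20's stub 1, ONE run letter `RunConstRemainder β₁₃(F; a₀, ε₂₉) 0 β′ γ₀` per admissible threshold (NODE O,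
print-faithful [I] Thm 3)}.  CONDITIONAL on both texts (displayed, NOT inhabited here); K0⁷ OPEN; a helper, not a closer.
[cite: Balaban1985Variational, Thm 1 (8)–(9) p.279, (144)–(152) pp.300–301, Prop. 8 p.304, p.304 lines 1–2; Balaban1985RegularSpaces, Prop. 6 p.99, p.98; Balaban1988Convergent, Thm 1 p.262, (2.6)–(2.8) pp.255–256; Balaban1987RG1, Thm 1 p.259, Thm 3 p.264; Balaban1989LargeFieldII, p.355] -/
theorem record13SepCoPHInhabited_of_stub1R_run3RR_byName
    (h1R : ∀ F : T4Family, ∃ (c : ℕ) (B₃ a₀ a₁ : ℝ), 2 * (F.L : ℝ) ^ 2 ≤ B₃ ∧ 0 < a₀ ∧ 0 < a₁ ∧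
      Prop8RegSepTopStepR F 2 (fun ν K Ω => suppDomOfRecord F ν K Ω) c B₃ a₀ a₁)
    (h3RR : ∀ (F : T4Family) (j c : ℕ) (B₃ B₃' a₀ a₁ : ℝ), c ≤ F.L ^ j → 2 * (F.L : ℝ) ^ 2 ≤ B₃ → 0 < B₃' → 0 < a₀ → 0 < a₁ →
      VariationalThm1RegSepCoP7MR F 2 c B₃ a₀ a₁ →
      Gauge9RegSepTopStepR F 2 (fun ν K Ω => suppDomOfRecord F ν K Ω) (F.L ^ j) c B₃ B₃' a₀ a₁ →
      ∃ γ₀ ε₀ ε₂₉ β' : ℝ, 0 < γ₀ ∧ 0 < ε₀ ∧ 0 < ε₂₉ ∧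
        RunConstRemainder (betaOfRecord₁₃ F 2 (theta13OfThm1CCM F 2 j ε₀ ε₂₉ B₃ B₃' a₀ a₁)) (fun _ => 0) β' γ₀) :
    Summit.QuantumFields.YangMills.Theses.BalabanUVNodes.Record13SepCoPHInhabited :=
  record13SepCoPHBody_of_stub1R_of_gauge9SupplierR_of_run3RR h1R
    (fun F c B₃ a₀ a₁ hB₃ ha₀ ha₁ h8 => gauge9SupplierR_of_prop6MemberP F (stub_prop6MemberB8AtP13 F) c B₃ a₀ a₁ hB₃ ha₀ ha₁ h8) h3RR

/-- **★★ K0⁷ BY NAME FROM THE V20-R STUB-1 TEXT AND 3ᴿ-G♭** (the guarded run text with the level binder; §1's `run3RR_of_run3RGb`).  CONDITIONAL on both texts; K0⁷ OPEN; a helper, not a closer.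
[cite: Balaban1985Variational, Thm 1 (8)–(9) p.279, Prop. 8 p.304, p.304 lines 1–2; Balaban1985RegularSpaces, Prop. 6 p.99; Balaban1988Convergent, Thm 1 p.262; Balaban1987RG1, Thm 1 p.259, Thm 3 p.264, (0.1) p.251] -/
theorem record13SepCoPHInhabited_of_stub1R_run3RGb_byName
    (h1R : ∀ F : T4Family, ∃ (c : ℕ) (B₃ a₀ a₁ : ℝ), 2 * (F.L : ℝ) ^ 2 ≤ B₃ ∧ 0 < a₀ ∧ 0 < a₁ ∧
      Prop8RegSepTopStepR F 2 (fun ν K Ω => suppDomOfRecord F ν K Ω) c B₃ a₀ a₁)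
    (h3RGb : ∀ (F : T4Family) (j c c₀ : ℕ) (B₃ B₃' a₀ a₁ : ℝ), c ≤ F.L ^ j → c₀ ≤ j + 1 → 2 * (F.L : ℝ) ^ 2 ≤ B₃ → 0 < B₃' → 0 < a₀ → 0 < a₁ →
      VariationalThm1RegSepCoP7MG F 2 (fun ν _M _g K k _s => c ≤ ν.M₁ ∧ k + c₀ ≤ F.m + K) B₃ a₀ a₁ →
      Gauge9RegSepTopStepG F 2 (fun ν K Ω => suppDomOfRecord F ν K Ω) (F.L ^ j) (fun ν _M _g K k _s => c ≤ ν.M₁ ∧ k + c₀ ≤ F.m + K) B₃ B₃' a₀ a₁ →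
      ∃ γ₀ ε₀ ε₂₉ β' : ℝ, 0 < γ₀ ∧ 0 < ε₀ ∧ 0 < ε₂₉ ∧
        RunConstRemainder (betaOfRecord₁₃ F 2 (theta13OfThm1CCM F 2 j ε₀ ε₂₉ B₃ B₃' a₀ a₁)) (fun _ => 0) β' γ₀) :
    Summit.QuantumFields.YangMills.Theses.BalabanUVNodes.Record13SepCoPHInhabited :=
  record13SepCoPHInhabited_of_stub1R_run3RR_byName h1R fun F => run3RR_of_run3RGb F (h3RGb F)

/-- **★★★ K0⁷ BY NAME FROM THE V20-R STUB-1 TEXT AND THE TOKEN-FREE RUN CORE** (ONE run letter of `β₁₃(F; a₀, ε₂₉)` per threshold — text-independent).  CONDITIONAL; K0⁷ OPEN; a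
helper, not a closer. [cite: Balaban1985Variational, Thm 1 (8)–(9) p.279, Prop. 8 p.304, p.304 lines 1–2; Balaban1985RegularSpaces, Prop. 6 p.99; Balaban1988Convergent, Thm 1 p.262; Balaban1987RG1, Thm 1 p.259, Thm 3 p.264; Balaban1989LargeFieldII, p.355] -/
theorem record13SepCoPHInhabited_of_stub1R_tokenFreeRun_byName
    (h1R : ∀ F : T4Family, ∃ (c : ℕ) (B₃ a₀ a₁ : ℝ), 2 * (F.L : ℝ) ^ 2 ≤ B₃ ∧ 0 < a₀ ∧ 0 < a₁ ∧
      Prop8RegSepTopStepR F 2 (fun ν K Ω => suppDomOfRecord F ν K Ω) c B₃ a₀ a₁)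
    (hT : ∀ (F : T4Family) (a₀ : ℝ), 0 < a₀ → ∃ γ₀ ε₂₉ β' : ℝ, 0 < γ₀ ∧ 0 < ε₂₉ ∧ ∀ (j : ℕ) (ε₀ B₃ B₃' a₁ : ℝ),
      RunConstRemainder (betaOfRecord₁₃ F 2 (theta13OfThm1CCM F 2 j ε₀ ε₂₉ B₃ B₃' a₀ a₁)) (fun _ => 0) β' γ₀) :
    Summit.QuantumFields.YangMills.Theses.BalabanUVNodes.Record13SepCoPHInhabited :=
  record13SepCoPHInhabited_of_stub1R_run3RR_byName h1R fun F => run3RR_of_tokenFreeRun F (hT F)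

/-- **K0⁷ BY NAME FROM THE V20-R STUB-1 TEXT AND ANY θ-GENERIC SUB-WINDOW BOX ROAD INHABITED AT ONE OF A1's WITNESSES PER THRESHOLD** (§2's schema per family, box ⟹ runs).  CONDITIONAL on
`h1R`, the roads and their packages `P F` (displayed, inhabited nowhere); K0⁷ OPEN; a helper, not a closer.
[cite: Balaban1985Variational, Thm 1 (8)–(9) p.279, Prop. 8 p.304; Balaban1985RegularSpaces, Prop. 6 p.99; Balaban1988Convergent, Thm 1 p.262; Balaban1987RG1, Thm 1 p.255, §1 p.264, Thm 3 p.264, (5.10) p.293; Balaban1988RG2Cluster, Lemma 3 (2.38) p.20] -/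
theorem record13SepCoPHInhabited_of_stub1R_genericRoadAtWitness_byName
    (h1R : ∀ F : T4Family, ∃ (c : ℕ) (B₃ a₀ a₁ : ℝ), 2 * (F.L : ℝ) ^ 2 ≤ B₃ ∧ 0 < a₀ ∧ 0 < a₁ ∧
      Prop8RegSepTopStepR F 2 (fun ν K Ω => suppDomOfRecord F ν K Ω) c B₃ a₀ a₁)
    (P : (F : T4Family) → Stage13Params F 2 → Prop)
    (hroad : ∀ (F : T4Family) (θ : Stage13Params F 2), P F θ →
      ∃ γ₀ β' : ℝ, 0 < γ₀ ∧ BetaLowerH (-β') γ₀ (betaOfRecord₁₃ F 2 θ) ∧ BetaUpperH β' γ₀ (betaOfRecord₁₃ F 2 θ))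
    (hAt : ∀ (F : T4Family) (a₀ : ℝ), 0 < a₀ → ∃ (j : ℕ) (ε₀ ε₂₉ B₃ B₃' a₁ : ℝ), 0 < ε₂₉ ∧ P F (theta13OfThm1CCM F 2 j ε₀ ε₂₉ B₃ B₃' a₀ a₁)) :
    Summit.QuantumFields.YangMills.Theses.BalabanUVNodes.Record13SepCoPHInhabited :=
  record13SepCoPHInhabited_of_stub1R_run3RR_byName h1R fun F => run3RR_of_tokenFree F (tokenFree_of_genericRoadAtWitness F (P F) (hroad F) (hAt F))

/-- **K0⁷ BY NAME FROM V19's REGISTERED STUB-1 TEXT AND 3ᴿ-R** (§1's `run3RV19_of_run3RR`, then p607023's `record13SepCoPHInhabited_of_stub1_run3R_byName`): while V19 STANDS, a by-name proof of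
`stub_prop8StepCoP13` together with the R-lettered run face closes K0⁷ through this line.  CONDITIONAL on both texts; K0⁷ OPEN; a helper, not a closer.
[cite: Balaban1985Variational, Thm 1 (8)–(9) p.279, Prop. 8 p.304; Balaban1985RegularSpaces, Prop. 6 p.99; Balaban1988Convergent, Thm 1 p.262; Balaban1987RG1, Thm 1 p.259, Thm 3 p.264] -/
theorem record13SepCoPHInhabited_of_stub1_run3RR_byName (h1 : ∀ F : T4Family, Prop8StepCoPAt F)
    (h3RR : ∀ (F : T4Family) (j c : ℕ) (B₃ B₃' a₀ a₁ : ℝ), c ≤ F.L ^ j → 2 * (F.L : ℝ) ^ 2 ≤ B₃ → 0 < B₃' → 0 < a₀ → 0 < a₁ →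
      VariationalThm1RegSepCoP7MR F 2 c B₃ a₀ a₁ →
      Gauge9RegSepTopStepR F 2 (fun ν K Ω => suppDomOfRecord F ν K Ω) (F.L ^ j) c B₃ B₃' a₀ a₁ →
      ∃ γ₀ ε₀ ε₂₉ β' : ℝ, 0 < γ₀ ∧ 0 < ε₀ ∧ 0 < ε₂₉ ∧
        RunConstRemainder (betaOfRecord₁₃ F 2 (theta13OfThm1CCM F 2 j ε₀ ε₂₉ B₃ B₃' a₀ a₁)) (fun _ => 0) β' γ₀) :
    Summit.QuantumFields.YangMills.Theses.BalabanUVNodes.Record13SepCoPHInhabited :=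
  record13SepCoPHInhabited_of_stub1_run3R_byName h1 fun F => run3RV19_of_run3RR F (h3RR F)

end ByName

end Summit.QuantumFields.YangMills.Theorems.K0Stub3V20RunSockets

end
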